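import Summits.NavierStokesRegularity.NavierStokesRegularity.Theorems.ExtremiserTransiencePerFlowPieceSelection
import HarnessLib

/-!
# Route `ExtremiserTransience`, LINE g4-α «per-flow-tangent» (ns-idea-5 g4): piece selection with LOCALISATION ERRORS

`--supports stmt-NavierStokesRegularity-26568` (`TangentExtremalExtraction`).  In the extraction step of skeleton v3d the pieces are
the restrictions of a slice to cubes of side `A·λ` (`λ² = Z/P`, the locked scale); `Z, P, J` are additive over the cubes, but the
universal depletion bound holds on a cube only up to a cut-off error, `J_Q ≤ κ·M_Q·√Z_Q·√P_Q + e_Q`.  This file records the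
error-tolerant forms of `amplitude_of_efficient_piece`: with an error `e ≤ ε·M·√Zᵢ·√Pᵢ` relative to the global amplitude the
selected `R`-efficient piece still has amplitude `Mᵢ ≥ ((R − ε)/κ)·M`, and in absolute form `(R·M − κ·Mᵢ)·√Zᵢ√Pᵢ ≤ e`.
HONEST FRAMING: elementary real inequalities; nothing about Navier–Stokes regularity or blow-up is proved. [folklore]
-/

noncomputable section

open Finset
open scoped BigOperators

namespace Summit.NavierStokesRegularity.NavierStokesRegularity.Theorems.DepletionLadder.PerFlow
set_option linter.dupNamespace false
set_option linter.style.longLine false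

/-- **Amplitude of an efficient piece, absolute localisation error.** [folklore] -/
theorem amplitude_defect_le_err {κ R M Mi Zi Pi Ji e : ℝ}
    (huniv : Ji ≤ κ * Mi * Real.sqrt Zi * Real.sqrt Pi + e) (heff : R * M * Real.sqrt Zi * Real.sqrt Pi ≤ Ji) :
    (R * M - κ * Mi) * (Real.sqrt Zi * Real.sqrt Pi) ≤ e := by
  have := heff.trans huniv
  have h' : (R * M - κ * Mi) * (Real.sqrt Zi * Real.sqrt Pi) =
      R * M * Real.sqrt Zi * Real.sqrt Pi - κ * Mi * Real.sqrt Zi * Real.sqrt Pi := by ring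
  linarith

/-- **Amplitude of an efficient piece, relative localisation error.**  If the universal bound holds on the piece up to an error
`ε·M·√Zᵢ·√Pᵢ` (relative to the GLOBAL amplitude `M`), an `R`-efficient non-degenerate piece has `Mᵢ ≥ ((R − ε)/κ)·M`. [folklore] -/
theorem amplitude_of_efficient_piece_relErr {κ R M Mi Zi Pi Ji ε : ℝ} (hκ : 0 < κ)
    (hpos : 0 < Real.sqrt Zi * Real.sqrt Pi)
    (huniv : Ji ≤ κ * Mi * Real.sqrt Zi * Real.sqrt Pi + ε * M * Real.sqrt Zi * Real.sqrt Pi)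
    (heff : R * M * Real.sqrt Zi * Real.sqrt Pi ≤ Ji) :
    (R - ε) / κ * M ≤ Mi := by
  have h1 : (R - ε) * M * (Real.sqrt Zi * Real.sqrt Pi) ≤ κ * Mi * (Real.sqrt Zi * Real.sqrt Pi) := by
    have := heff.trans huniv
    have e1 : (R - ε) * M * (Real.sqrt Zi * Real.sqrt Pi) =
        R * M * Real.sqrt Zi * Real.sqrt Pi - ε * M * Real.sqrt Zi * Real.sqrt Pi := by ring
    have e2 : κ * Mi * (Real.sqrt Zi * Real.sqrt Pi) = κ * Mi * Real.sqrt Zi * Real.sqrt Pi := by ring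
    linarith
  have h2 : (R - ε) * M ≤ κ * Mi := le_of_mul_le_mul_right h1 hpos
  rw [div_mul_eq_mul_div, div_le_iff₀ hκ]
  linarith

/-- **Selection of an efficient, heavy piece with localisation errors.**  As `exists_efficient_heavy_piece`, with the per-piece
universal bound weakened to `Jᵢ ≤ κ Mᵢ √Zᵢ √Pᵢ + ε M √Zᵢ √Pᵢ`: some non-degenerate piece is `R`-efficient at the global amplitude
and has `Mᵢ ≥ ((R − ε)/κ) M`. [folklore] -/
theorem exists_efficient_heavy_piece_relErr {ι : Type*} (s : Finset ι) {Zp Pp Jp Mp : ι → ℝ}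
    (hZ : ∀ i, 0 ≤ Zp i) (hP : ∀ i, 0 ≤ Pp i) {κ R M ε : ℝ} (hκ : 0 < κ) (hR : 0 < R) (hM : 0 < M)
    (huniv : ∀ i ∈ s, Jp i ≤ κ * Mp i * Real.sqrt (Zp i) * Real.sqrt (Pp i) + ε * M * Real.sqrt (Zp i) * Real.sqrt (Pp i))
    (hglob : 0 < Real.sqrt (∑ i ∈ s, Zp i) * Real.sqrt (∑ i ∈ s, Pp i))
    (hJ : R * M * Real.sqrt (∑ i ∈ s, Zp i) * Real.sqrt (∑ i ∈ s, Pp i) ≤ ∑ i ∈ s, Jp i) :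
    ∃ i ∈ s, R * M * Real.sqrt (Zp i) * Real.sqrt (Pp i) ≤ Jp i ∧
      0 < Real.sqrt (Zp i) * Real.sqrt (Pp i) ∧ (R - ε) / κ * M ≤ Mp i := by
  classical
  -- apply the exact selection with the fictitious amplitudes `Mᵢ' = Mᵢ + (ε/κ) M`, for which the universal bound is exact
  have huniv' : ∀ i ∈ s, Jp i ≤ κ * (Mp i + ε / κ * M) * Real.sqrt (Zp i) * Real.sqrt (Pp i) := by
    intro i hi
    have e1 : κ * (Mp i + ε / κ * M) * Real.sqrt (Zp i) * Real.sqrt (Pp i) =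
        κ * Mp i * Real.sqrt (Zp i) * Real.sqrt (Pp i) + ε * M * Real.sqrt (Zp i) * Real.sqrt (Pp i) := by
      field_simp
    rw [e1]; exact huniv i hi
  -- the degenerate pieces contribute `Jᵢ ≤ 0`; restrict to non-degenerate ones as in the exact case
  set s' : Finset ι := s.filter fun i => 0 < Real.sqrt (Zp i) * Real.sqrt (Pp i) with hs'
  have hdeg : ∀ i ∈ s, i ∉ s' → Jp i ≤ 0 := by
    intro i hi hi'
    have h0 : ¬ 0 < Real.sqrt (Zp i) * Real.sqrt (Pp i) := fun h => hi' (Finset.mem_filter.2 ⟨hi, h⟩)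
    have hzp : Real.sqrt (Zp i) * Real.sqrt (Pp i) = 0 :=
      le_antisymm (not_lt.1 h0) (mul_nonneg (Real.sqrt_nonneg _) (Real.sqrt_nonneg _))
    calc Jp i ≤ κ * (Mp i + ε / κ * M) * Real.sqrt (Zp i) * Real.sqrt (Pp i) := huniv' i hi
      _ = κ * (Mp i + ε / κ * M) * (Real.sqrt (Zp i) * Real.sqrt (Pp i)) := by ring
      _ = 0 := by rw [hzp, mul_zero]
  have hZle : ∑ i ∈ s', Zp i ≤ ∑ i ∈ s, Zp i := Finset.sum_le_sum_of_subset_of_nonneg (Finset.filter_subset _ _) fun i _ _ => hZ i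
  have hPle : ∑ i ∈ s', Pp i ≤ ∑ i ∈ s, Pp i := Finset.sum_le_sum_of_subset_of_nonneg (Finset.filter_subset _ _) fun i _ _ => hP i
  have hJle : ∑ i ∈ s, Jp i ≤ ∑ i ∈ s', Jp i := by
    rw [← Finset.sum_filter_add_sum_filter_not s (fun i => 0 < Real.sqrt (Zp i) * Real.sqrt (Pp i)) Jp]
    have : ∑ i ∈ s.filter (fun i => ¬ 0 < Real.sqrt (Zp i) * Real.sqrt (Pp i)), Jp i ≤ 0 :=
      Finset.sum_nonpos fun i hi => by
        rw [Finset.mem_filter] at hi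
        exact hdeg i hi.1 (fun h => hi.2 (Finset.mem_filter.1 h).2)
    linarith
  have hRM : 0 ≤ R * M := (mul_pos hR hM).le
  have hJ' : R * M * Real.sqrt (∑ i ∈ s', Zp i) * Real.sqrt (∑ i ∈ s', Pp i) ≤ ∑ i ∈ s', Jp i := by
    have h1 : Real.sqrt (∑ i ∈ s', Zp i) * Real.sqrt (∑ i ∈ s', Pp i) ≤
        Real.sqrt (∑ i ∈ s, Zp i) * Real.sqrt (∑ i ∈ s, Pp i) :=
      mul_le_mul (Real.sqrt_le_sqrt hZle) (Real.sqrt_le_sqrt hPle) (Real.sqrt_nonneg _) (Real.sqrt_nonneg _)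
    have h2 := mul_le_mul_of_nonneg_left h1 hRM
    calc R * M * Real.sqrt (∑ i ∈ s', Zp i) * Real.sqrt (∑ i ∈ s', Pp i)
        = R * M * (Real.sqrt (∑ i ∈ s', Zp i) * Real.sqrt (∑ i ∈ s', Pp i)) := by ring
      _ ≤ R * M * (Real.sqrt (∑ i ∈ s, Zp i) * Real.sqrt (∑ i ∈ s, Pp i)) := h2
      _ = R * M * Real.sqrt (∑ i ∈ s, Zp i) * Real.sqrt (∑ i ∈ s, Pp i) := by ring
      _ ≤ ∑ i ∈ s, Jp i := hJ
      _ ≤ ∑ i ∈ s', Jp i := hJle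
  have hs'ne : s'.Nonempty := by
    by_contra hemp
    rw [Finset.not_nonempty_iff_eq_empty] at hemp
    have h0 : ∑ i ∈ s', Jp i = 0 := by rw [hemp, Finset.sum_empty]
    have : 0 < R * M * Real.sqrt (∑ i ∈ s, Zp i) * Real.sqrt (∑ i ∈ s, Pp i) := by
      have := mul_pos (mul_pos hR hM) hglob
      calc (0 : ℝ) < R * M * (Real.sqrt (∑ i ∈ s, Zp i) * Real.sqrt (∑ i ∈ s, Pp i)) := this
        _ = _ := by ring
    linarith
  obtain ⟨i, hi', heff⟩ := exists_efficient_piece s' hs'ne hZ hP hR.le hM.le hJ'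
  have hi : i ∈ s := (Finset.mem_filter.1 hi').1
  have hposi : 0 < Real.sqrt (Zp i) * Real.sqrt (Pp i) := (Finset.mem_filter.1 hi').2
  exact ⟨i, hi, heff, hposi, amplitude_of_efficient_piece_relErr hκ hposi (huniv i hi) heff⟩

end Summit.NavierStokesRegularity.NavierStokesRegularity.Theorems.DepletionLadder.PerFlow

end
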